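/-
Copyright (c) 2026 the pub-hodgecm-mathlib formalisation cell (harness21).  Prover seat hodgecm-mathlib-LH10-p02 (g12); G-rows dealer ∕ reader F0P3a-p09 (g13) (LEAD F0P3a-plan
(g15) T14-69 (1), rule-20 brick); CENSUS «EP-G» v1 §5 ∕ G-ROW LEDGER v2 rows (G3) «EP-G glue» + (G1c) part (T1); 2026-09-02.
-/
import Summits.HodgeConjecture.HodgeConjecture.Theorems.F0P3cStCharTSEllCartanCompact   -- ★ `isCompact_centralizer_iff_not_mem_hyperbolicSet`; brings `Gqs`, `hyperbolicSet`, the CM one-place kit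
import Literature.NumberTheory.Rogawski1990.RankOneEulerPoincareGlue                   -- ★ `classOrbitalIntegral_epCombination_eq(_of_compactSpace)`, `isLocSmooth_epCombination`, `IsLocSmooth`
import Literature.NumberTheory.Rogawski1990.EulerPoincareNonEllipticThree             -- ★ (G1) ASSEMBLY (LH6-p03): `epNonEllipticCombination_eq_zero_three` (the non-elliptic relation, kit binders (T1)(T2))
import Literature.NumberTheory.Automorphic.UnitaryGroupSplitTorusRankOneThree          -- ★ (G1c)-(T2) p852912 (this seat): diagonal-unitary relations, `exists_splitTorus_generator_local_of_nonsplit_three`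
import Literature.NumberTheory.Automorphic.SelfDualLatticeCountFrameTransportCM        -- ★ `valued_toPlace_uniformizer`
import Literature.NumberTheory.Automorphic.UnitaryLatticeTreeLevelIndices             -- ★ (G0) p852870 (this seat): compact-open `K₀`∕`K₁`∕`K₀ ⊓ K₁`, indices `q³+1`∕`q+1`
import Literature.NumberTheory.Automorphic.UnitaryLatticeTreeLevelIndexSign           -- ★ (G7) p852871 (this seat): `measureReal_coe_eq_index_mul`, `epValueAtOne_eq_and_neg`
import Literature.NumberTheory.Automorphic.HyperspecialUnitaryCartanAdicCompletion     -- ★ `unramifiedLocalConjDatum_adicCompletion`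
import Literature.NumberTheory.Automorphic.UnitaryLatticeTreeValencyInertPlace       -- ★ residual data `σk`, `|𝓀| = q²`, `σk = Frob_q` at an inert place
import Literature.NumberTheory.Automorphic.UnitaryLatticeTreeEulerRelation          -- ★ EULER-G `natCard_fixedBy_add_eq_natCard_fixedBy_inf_add_one_three`
import Literature.NumberTheory.Automorphic.FixedCosetsFiniteOfCompactCentralizer       -- ★ `finite_range_pow_quotient_of_isOpen`, `finite_fixedBy_quotient_of_isClosed`
import Literature.NumberTheory.Automorphic.LocalRegularOrbitClosed                     -- ★ `isClosed_conjClass_local_of_isRegularElt`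
import HarnessLib

/-!
# F0 · P3c · line LH6 «StCharTS» — CENSUS «EP-G» (G3) «EP-G GLUE»: KOTTWITZ'S EULER–POINCARÉ FUNCTION ON `G_v = U(Φ₃)(L⁺_v)` (non-split `v`), and (G1c) part (T1)
# «a regular element with non-compact centraliser is conjugate into the diagonal torus, diagonally in the one-place model» [Kottwitz1988 §2 Thm. 2; Rogawski1990 §12.6]

THEOREMS ONLY (SIG «=» F0P3a-p09 (g13) 22:52:35Z); lane `--kind proof --supports stmt-HodgeConjecture-24833 --as helper`; count-neutral (closes no node; the EP-G
instances K1∕K2′∕POS-ONE at `St(ψ)` are paid only at t1′).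

* §0 (T1) `exists_conj_coe_localNonsplitEquiv_eq_diagonal_of_not_isCompact_centralizer` — for `γ ∈ G_v` regular with NON-compact centraliser there are `x ∈ G_v`, a REGULAR diagonal
  `e γ′ = diagonal d` (`γ′ = x γ x⁻¹`), with the valuation profile `|d 0| = |ϖ|^c`, `|d 1| = 1`, `|d 2| = |ϖ|^(−c)` (`ϖ = ι_w ϖ_v`) — ★ `isCompact_centralizer_iff_not_mem_hyperbolicSet` unpacked
  through ★ `localNonsplitEquiv_apply_apply` and the diagonal-unitary relations of ★ (G1c) §1.
* §1 (G3) **`exists_epFunction_G`** — for every Haar `νQv` on `G_v` and every family `mQv` canonical for (`IsRegularElt`, `νQv`): `∃ f_G`, locally constant compactly supported,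
  measurable, integrable, `∫ f_G dνQv = 1`, `f_G 1 = νQv(K₀)⁻¹ + νQv(K₁)⁻¹ − νQv(I)⁻¹` with NEGATIVE real part (★ (G7)), canonical orbital integral `1` at every regular class with
  COMPACT centraliser and `0` at every regular class with NON-compact centraliser.  `f_G := νQv(K₀)⁻¹𝟙_{K₀} + νQv(K₁)⁻¹𝟙_{K₁} − νQv(I)⁻¹𝟙_I` EXPLICITLY, the levels
  `K₀ = (glInt 3).subgroupOf U`, `K₁ = ((glInt 3).map (conj g₁)).subgroupOf U`, `I = K₀ ⊓ K₁` of `U = U(σ_w, J₀)(L_w)` pulled back along the one-place model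
  `eA : G_v ≃ₜ* U` (★ `localNonsplitEquiv` re-read on `J₀ = (StdForm.antidiagonal 3).over L_w`; compact-open ★ (G0)); sign = ★ (G0) indices `q³+1`∕`q+1` + ★ (G7);
  (E) = ★ EULER-G `natCard_fixedBy_add_eq_natCard_fixedBy_inf_add_one_three` (finiteness from the compact centraliser and the closed regular class, counts moved along `eA`);
  (N) = ★ (G1) ASSEMBLY `epNonEllipticCombination_eq_zero_three` with (T1) := §0 and (T2) := ★ `exists_splitTorus_generator_local_of_nonsplit_three`.

HONEST LABEL: count-neutral; h413 OPEN; HC_CM is proved only modulo the 7 printed citations (2 remaining named inputs hLiu418 = `stmt-HodgeConjecture-24832`, h413 =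
`stmt-HodgeConjecture-24833`) until rung 0 closes.

## References
* [Kottwitz1988] R. E. Kottwitz, *Tamagawa numbers*, Ann. of Math. 127 (1988), §2 Theorem 2 (Euler–Poincaré functions on a rank-one group; `Φ(γ, f_EP) = χ(𝒯^γ)`).
* [Rogawski1990] J. D. Rogawski, *Automorphic Representations of Unitary Groups in Three Variables* (1990), §12.6 p. 187 (pseudo-coefficients), §4.9 p. 54, §3.6 pp. 28–31.
* [Tits1979] J. Tits, *Reductive groups over local fields*, PSPM 33.1 (1979), §2.4; §1.2 pp. 31–32, §1.15 p. 40.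
* [Serre1980Trees] J.-P. Serre, *Trees* (1980), II.1.1–1.3.
-/

set_option autoImplicit false
-- the mandated namespace has the single-problem summit's repeated segment (`HodgeConjecture.HodgeConjecture`)
set_option linter.dupNamespace false

noncomputable section

open NumberField IsDedekindDomain MeasureTheory Topology
open scoped Matrix MatrixGroups Valued
open Literature.NumberTheory.Rogawski1990 Literature.NumberTheory.Automorphic Literature.NumberTheory.Automorphic.UnitaryGroup
open Literature.NumberTheory.GaloisRepresentations
open Summit.HodgeConjecture.HodgeConjecture.Cruxes.H413.F0P3cStCharTSTorusDefs

namespace Summit.HodgeConjecture.HodgeConjecture.Cruxes.H413.F0P3cStCharTSEPGlueG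

variable (L : Type) [Field L] [NumberField L] [IsCMField L] (v : HeightOneSpectrum (𝓞 ↥(maximalRealSubfield L)))

/-! ## §0 (G1c) part (T1): regular elements with non-compact centraliser are conjugate into the diagonal torus -/

set_option maxHeartbeats 400000 in  -- ED. 2 (owner, ops-buildfix N6 2026-09-03): (T1) measured on a 160k–200k heartbeat cliff (FAIL 160k∕180k, PASS 200k); budget ×2, 0 statement∕proof bytes moved
/-- **(T1)** — a REGULAR `γ ∈ U(Φ₃)(L⁺_v)` (`v` non-split) whose centraliser is NOT compact is conjugate (`IsConj γ γ′`) to an element `γ′` whose one-place image `e γ′ ∈ U(σ_w, (Φ₃)_w)(L_w)` is a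
REGULAR DIAGONAL matrix `diagonal d` with `|d 0|_w = |ϖ|^c`, `|d 1|_w = 1`, `|d 2|_w = |ϖ|^(−c)` for `ϖ = ι_w ϖ_v` and some `c ∈ ℤ` (★ `isCompact_centralizer_iff_not_mem_hyperbolicSet`:
`γ ∈ Ω` = conjugate of a regular diagonal-torus element; ★ `localNonsplitEquiv_apply_apply`; the torus relations `σ_w(d₀)·d₂ = 1`, `σ_w(d₁)·d₁ = 1`).
[cite: Rogawski1990, §3.6 pp. 28–31; §12.5 p. 182] [cite: Tits1979, §1.2 pp. 31–32; §1.15 p. 40] -/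
theorem exists_conj_coe_localNonsplitEquiv_eq_diagonal_of_not_isCompact_centralizer
    (hns : ∀ w : PlacesOver L v, IsCMField.complexConj L • w.1 = w.1) (hunr : Algebra.IsUnramifiedIn (𝓞 L) v.asIdeal)
    (w : PlacesOver L v) (hw : IsCMField.complexConj L • w.1 = w.1)
    {γ : Gqs L v} (hreg : IsRegularElt (γ.val : GL (Fin 3) (UnitaryGroup.LocalRing L v)))
    (hnc : ¬ IsCompact ((Subgroup.centralizer ({γ} : Set (Gqs L v))) : Set (Gqs L v))) :
    ∃ (γ' : Gqs L v) (d : Fin 3 → w.1.adicCompletion L) (c : ℤ), IsConj γ γ' ∧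
      (((localNonsplitEquiv (IsCMField.complexConj L) (qsForm L) (IsCMField.complexConj_ne_one L) w hw γ' :
          ↥(unitaryGroupOfForm (galAdicCompletionMap (L := L) (IsCMField.complexConj L) hw) (placeForm (qsForm L) w.1))) :
            GL (Fin 3) (w.1.adicCompletion L)) : Matrix (Fin 3) (Fin 3) (w.1.adicCompletion L)) = Matrix.diagonal d ∧
      (∀ i j : Fin 3, i ≠ j → IsUnit (d i - d j)) ∧
      Valued.v (d 0) = Valued.v ((toPlace v w (HeckeCharacter.uniformizer ↥(maximalRealSubfield L) v : v.adicCompletion ↥(maximalRealSubfield L))) ^ c) ∧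
      Valued.v (d 1) = 1 ∧
      Valued.v (d 2) = Valued.v ((toPlace v w (HeckeCharacter.uniformizer ↥(maximalRealSubfield L) v : v.adicCompletion ↥(maximalRealSubfield L))) ^ (-c)) := by
  set σ := galAdicCompletionMap (L := L) (IsCMField.complexConj L) hw with hσdef
  set eU := localNonsplitEquiv (IsCMField.complexConj L) (qsForm L) (IsCMField.complexConj_ne_one L) w hw with heUdef
  set ϖ : w.1.adicCompletion L := toPlace v w (HeckeCharacter.uniformizer ↥(maximalRealSubfield L) v : v.adicCompletion ↥(maximalRealSubfield L)) with hϖdef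
  have hvϖ : Valued.v ϖ = WithZero.exp (-1 : ℤ) := valued_toPlace_uniformizer L v w hunr
  -- `γ` is hyperbolic: conjugate to a regular diagonal-torus element `t`
  have hΩ : γ ∈ hyperbolicSet L v := by
    by_contra hΩ
    exact hnc ((F0P3cStCharTSEllCartanCompact.isCompact_centralizer_iff_not_mem_hyperbolicSet L v hns hreg).2 hΩ)
  obtain ⟨t, htreg, htconj⟩ := hΩ
  -- the diagonal entries of `t`, read at `w`
  obtain ⟨dU, hdU⟩ := (mem_torusU_iff (σ := conjLocal L (IsCMField.complexConj L) v) (J := cmLocalForm L 3 v)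
    (t : ↥(unitaryGroupOfForm (conjLocal L (IsCMField.complexConj L) v) (cmLocalForm L 3 v)))).1 t.2
  set d : Fin 3 → w.1.adicCompletion L := fun i => ((dU i : LocalRing L v)) w with hddef
  have heUt : (((eU ((t : ↥(unitaryGroupOfForm (conjLocal L (IsCMField.complexConj L) v) (cmLocalForm L 3 v))) : Gqs L v) :
      ↥(unitaryGroupOfForm σ (placeForm (qsForm L) w.1))) : GL (Fin 3) (w.1.adicCompletion L)) : Matrix (Fin 3) (Fin 3) (w.1.adicCompletion L)) =
      Matrix.diagonal d := by
    rw [heUdef, coe_localNonsplitEquiv_apply L (qsForm L) v w hw]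
    change (((t : ↥(unitaryGroupOfForm (conjLocal L (IsCMField.complexConj L) v) (cmLocalForm L 3 v))) : GL (Fin 3) (LocalRing L v)) :
        Matrix (Fin 3) (Fin 3) (LocalRing L v)).map (Pi.evalRingHom (fun w' : PlacesOver L v => w'.1.adicCompletion L) w) = Matrix.diagonal d
    rw [← hdU, coe_glDiagonal, Matrix.diagonal_map (map_zero _)]
    rfl
  -- regularity of `d`
  have hsep : (Matrix.diagonal d).charpoly.Separable := by
    rw [← heUt]
    exact (TypeThreeTorus.isRegularElt_iff_separable_localNonsplitEquiv L w hw _).1 htreg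
  have hinj : Function.Injective d := by
    rw [Matrix.charpoly_diagonal] at hsep
    exact Polynomial.separable_prod_X_sub_C_iff.1 hsep
  have hdreg : ∀ i j : Fin 3, i ≠ j → IsUnit (d i - d j) := fun i j hij =>
    isUnit_iff_ne_zero.2 (sub_ne_zero.2 fun h => hij (hinj h))
  -- the torus relations at `w`: `σ_w(d₀)·d₂ = 1`, `σ_w(d₁)·d₁ = 1`
  have hform := TypeThreeTorus.placeForm_qsForm_eq L w
  have hH₀₂ : placeForm (qsForm L) w.1 0 2 ≠ 0 := by rw [hform]; exact one_ne_zero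
  have hH₁₁ : placeForm (qsForm L) w.1 1 1 ≠ 0 := by rw [hform]; exact one_ne_zero
  have hmem := (eU ((t : ↥(unitaryGroupOfForm (conjLocal L (IsCMField.complexConj L) v) (cmLocalForm L 3 v))) : Gqs L v)).2
  have h02 : σ (d 0) * d 2 = 1 := map_apply_zero_mul_apply_two_eq_one_of_mem_unitaryGroupOfForm σ hH₀₂ hmem heUt
  have h11 : σ (d 1) * d 1 = 1 := map_apply_one_mul_apply_one_eq_one_of_mem_unitaryGroupOfForm σ hH₁₁ hmem heUt
  have hσv : ∀ y : w.1.adicCompletion L, Valued.v (σ y) = Valued.v y := fun y => valued_galAdicCompletionMap (L := L) (IsCMField.complexConj L) hw y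
  have hv1 : Valued.v (d 1) = 1 := by
    have h := congrArg Valued.v h11
    rw [map_mul, map_one, hσv, ← pow_two] at h
    exact (pow_eq_one_iff.1 h).resolve_right two_ne_zero
  have hv02 : Valued.v (d 0) * Valued.v (d 2) = 1 := by
    have h := congrArg Valued.v h02
    rwa [map_mul, map_one, hσv] at h
  have hd0 : d 0 ≠ 0 := fun h0 => by rw [h0, map_zero, zero_mul] at hv02; exact zero_ne_one hv02
  have hvd0 : Valued.v (d 0) ≠ 0 := (Valuation.ne_zero_iff _).2 hd0
  -- `|d₀| = |ϖ|^c` with `c := −log|d₀|`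
  set m : ℤ := WithZero.log (Valued.v (d 0)) with hmdef
  have hvd0' : Valued.v (d 0) = WithZero.exp m := by rw [hmdef, WithZero.exp_log hvd0]
  refine ⟨((t : ↥(unitaryGroupOfForm (conjLocal L (IsCMField.complexConj L) v) (cmLocalForm L 3 v))) : Gqs L v), d, -m, htconj.symm, heUt, hdreg, ?_, hv1, ?_⟩
  · rw [map_zpow₀, hvϖ, ← WithZero.exp_zsmul, hvd0']
    congr 1; simp only [smul_eq_mul]; ring
  · rw [map_zpow₀, hvϖ, ← WithZero.exp_zsmul, eq_inv_of_mul_eq_one_right hv02, hvd0', ← WithZero.exp_neg]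
    congr 1; simp only [smul_eq_mul]; ring

/-! ## §1 (G3) Kottwitz's Euler–Poincaré function on `U(Φ₃)(L⁺_v)` -/

/-- Index transport along a group isomorphism: `[e⁻¹K : e⁻¹H ∩ e⁻¹K] = [K : H ∩ K]`. [folklore] -/
theorem index_subgroupOf_comap_mulEquiv {G G' : Type*} [Group G] [Group G'] (e : G ≃* G') (H K : Subgroup G') :
    ((H.comap e.toMonoidHom).subgroupOf (K.comap e.toMonoidHom)).index = (H.subgroupOf K).index := by
  rw [← Subgroup.relIndex, ← Subgroup.relIndex, Subgroup.relIndex_comap, Subgroup.map_comap_eq_self_of_surjective e.surjective]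


set_option maxHeartbeats 1600000 in  -- statement-level `whnf` on the CM carriers + five clauses, as in the ★ H-side twin `F0P3cStCharTSEllMassHEP.exists_epFunction_H`
/-- **(G3) «EP-G»: KOTTWITZ'S EULER–POINCARÉ FUNCTION ON `G_v = U(Φ₃)(L⁺_v)`** (`v` non-split, unramified datum; dyadic places included): for every Haar measure `νQv` and every
family `mQv` canonical for (`IsRegularElt`, `νQv`) there is `f_G : G_v → ℂ`, locally constant with compact support, measurable, integrable, with `∫ f_G dνQv = 1`, whose value at `1`
is the REAL NEGATIVE number `νQv(K₀)⁻¹ + νQv(K₁)⁻¹ − νQv(I)⁻¹` (★ (G7)), and whose canonical orbital integral is `1` at every regular class with COMPACT centraliser and `0` at every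
regular class with NON-compact centraliser (`f_G := νQv(K₀)⁻¹𝟙_{K₀} + νQv(K₁)⁻¹𝟙_{K₁} − νQv(I)⁻¹𝟙_I`, `K₀`∕`K₁` the two vertex stabilisers and `I` the Iwahori of the `U(3)` tree
pulled back along ★ `localNonsplitEquiv`).  EP inputs BY NAME: ★ `classOrbitalIntegral_epCombination_eq(_of_compactSpace)`, ★ (G0)∕(G7), ★ EULER-G, ★ (G1) ASSEMBLY
`epNonEllipticCombination_eq_zero_three` (kit binders (T1) := §0, (T2) := ★ `exists_splitTorus_generator_local_of_nonsplit_three`).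
[cite: Kottwitz1988, §2 Theorem 2] [cite: Rogawski1990, §12.6 p. 187] [cite: Tits1979, §2.4] [cite: Serre1980Trees, II.1.1] -/
theorem exists_epFunction_G (hns : ∀ w : PlacesOver L v, IsCMField.complexConj L • w.1 = w.1)
    (hunr : Algebra.IsUnramifiedIn (𝓞 L) v.asIdeal)
    [MeasurableSpace (Gqs L v)] [BorelSpace (Gqs L v)]
    [∀ γ : Gqs L v, MeasurableSpace (Gqs L v ⧸ Subgroup.centralizer ({γ} : Set (Gqs L v)))]
    [∀ γ : Gqs L v, BorelSpace (Gqs L v ⧸ Subgroup.centralizer ({γ} : Set (Gqs L v)))]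
    (νQv : Measure (Gqs L v)) [νQv.IsHaarMeasure] [νQv.IsMulRightInvariant]
    {mQv : OrbitalMeasureFamily (Gqs L v)}
    (hcanQ : mQv.IsCanonical (fun γ => IsRegularElt (γ.val : GL (Fin 3) (UnitaryGroup.LocalRing L v))) νQv) :
    ∃ fG : Gqs L v → ℂ, IsLocSmooth fG ∧ Measurable fG ∧ Integrable fG νQv ∧ ∫ g, fG g ∂νQv = 1 ∧
      (fG 1).im = 0 ∧ (fG 1).re < 0 ∧
      (∀ γ : Gqs L v, IsRegularElt (γ.val : GL (Fin 3) (UnitaryGroup.LocalRing L v)) →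
        IsCompact ((Subgroup.centralizer ({γ} : Set (Gqs L v))) : Set (Gqs L v)) → classOrbitalIntegral mQv fG (ConjClasses.mk γ) = 1) ∧
      (∀ γ : Gqs L v, IsRegularElt (γ.val : GL (Fin 3) (UnitaryGroup.LocalRing L v)) →
        ¬ IsCompact ((Subgroup.centralizer ({γ} : Set (Gqs L v))) : Set (Gqs L v)) → classOrbitalIntegral mQv fG (ConjClasses.mk γ) = 0) := by
  classical
  obtain ⟨w⟩ : Nonempty (PlacesOver L v) := inferInstance
  have hw : IsCMField.complexConj L • w.1 = w.1 := hns w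
  have hc1 : IsCMField.complexConj L ≠ 1 := IsCMField.complexConj_ne_one L
  haveI : Algebra.IsQuadraticExtension ↥(maximalRealSubfield L) L := IsCMField.isQuadraticExtension L
  have hHf : ((qsForm L).map (cmConjRingHom L))ᵀ = qsForm L := UnitaryGroup.antidiagOne_isHermitian L 3
  have hdetf : (qsForm L).det ≠ 0 := (UnitaryGroup.isUnit_antidiagOne_det L 3).ne_zero
  set σ := galAdicCompletionMap (L := L) (IsCMField.complexConj L) hw with hσdef
  -- the unramified datum at `w` and the one-place model
  obtain ⟨ϖ, hd⟩ := unramifiedLocalConjDatum_adicCompletion (IsCMField.complexConj L) hc1 v w hw hunr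
  set eU := localNonsplitEquiv (IsCMField.complexConj L) (qsForm L) hc1 w hw with heUdef
  -- the three levels, pulled back to `G_v`
  have hϖ0 : ϖ ≠ 0 := fun h0 => by have hv := hd.vϖ; rw [h0, map_zero] at hv; exact WithZero.zero_ne_coe hv
  set g₁ : GL (Fin 3) (w.1.adicCompletion L) :=
    glDiagonal 3 (w.1.adicCompletion L) ![1, 1, Units.mk0 ϖ hϖ0] with hg₁def
  have hg₁ : (g₁ : Matrix (Fin 3) (Fin 3) (w.1.adicCompletion L)) = Matrix.diagonal ![(1 : w.1.adicCompletion L), 1, ϖ] := by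
    rw [hg₁def, coe_glDiagonal]
    congr 1
    funext i
    fin_cases i <;> rfl
  -- re-read the one-place model on the literal form `Φ₃ = antidiag(1,1,1)` (★ EULER-G ∕ (G1) ∕ (G0) currency)
  have hJw : placeForm (qsForm L) w.1 = (StdForm.antidiagonal 3).over (w.1.adicCompletion L) := by
    rw [placeForm, qsForm, antidiagOne_eq_over, StdForm.over_map]
  set UA := unitaryGroupOfForm σ ((StdForm.antidiagonal 3).over (w.1.adicCompletion L)) with hUAdef
  obtain ⟨eA, heA⟩ : ∃ eA : Gqs L v ≃ₜ* ↥UA, ∀ g : Gqs L v, ((eA g : ↥UA) : GL (Fin 3) (w.1.adicCompletion L)) =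
      ((eU g : ↥(unitaryGroupOfForm σ (placeForm (qsForm L) w.1))) : GL (Fin 3) (w.1.adicCompletion L)) := by
    rw [hUAdef, ← hJw]
    exact ⟨eU, fun g => rfl⟩
  haveI hTG : IsTopologicalGroup ↥UA := inferInstance
  set K0w : Subgroup ↥UA := (glInt 3 (w.1.adicCompletion L)).subgroupOf UA with hK0wdef
  set K1w : Subgroup ↥UA := ((glInt 3 (w.1.adicCompletion L)).map (MulAut.conj g₁).toMonoidHom).subgroupOf UA with hK1wdef
  set K0 : Subgroup (Gqs L v) := K0w.comap eA.toMulEquiv.toMonoidHom with hK0def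
  set K1 : Subgroup (Gqs L v) := K1w.comap eA.toMulEquiv.toMonoidHom with hK1def
  set I : Subgroup (Gqs L v) := (K0w ⊓ K1w).comap eA.toMulEquiv.toMonoidHom with hIdef
  -- compact-open (★ (G0) §2 on `UA`, pulled back along the homeomorphism `eA`)
  have hσc : Continuous σ := continuous_galAdicCompletionMap L (IsCMField.complexConj L) hw
  haveI := compactSpace_integer_adicCompletion L w.1
  have hpre : ∀ C : Subgroup ↥UA, ((C.comap eA.toMulEquiv.toMonoidHom : Subgroup (Gqs L v)) : Set (Gqs L v)) = eA ⁻¹' (C : Set ↥UA) := fun _ => rfl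
  have hK0o : IsOpen (K0 : Set (Gqs L v)) := by
    rw [hK0def, hpre]; exact (UnitaryLatticeTree.isOpen_glInt_subgroupOf σ _).preimage eA.continuous
  have hK0c : IsCompact (K0 : Set (Gqs L v)) := by
    rw [hK0def, hpre]; exact eA.toHomeomorph.isCompact_preimage.2 (UnitaryLatticeTree.isCompact_glInt_subgroupOf σ _ hσc)
  have hK1o : IsOpen (K1 : Set (Gqs L v)) := by
    rw [hK1def, hpre]; exact (UnitaryLatticeTree.isOpen_conj_glInt_subgroupOf σ _ g₁).preimage eA.continuous
  have hK1c : IsCompact (K1 : Set (Gqs L v)) := by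
    rw [hK1def, hpre]; exact eA.toHomeomorph.isCompact_preimage.2 (UnitaryLatticeTree.isCompact_conj_glInt_subgroupOf σ _ g₁ hσc)
  have hIo : IsOpen (I : Set (Gqs L v)) := by
    rw [hIdef, hpre]; exact (UnitaryLatticeTree.isOpen_glInt_inf_conj_glInt_subgroupOf σ _ g₁).preimage eA.continuous
  have hIc : IsCompact (I : Set (Gqs L v)) := by
    rw [hIdef, hpre]; exact eA.toHomeomorph.isCompact_preimage.2 (UnitaryLatticeTree.isCompact_glInt_inf_conj_glInt_subgroupOf σ _ g₁ hσc)
  -- volumes of compact open subgroups are finite and positive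
  have hvol : ∀ S : Subgroup (Gqs L v), IsOpen (S : Set (Gqs L v)) → IsCompact (S : Set (Gqs L v)) → (((νQv S).toReal : ℂ)) ≠ 0 := by
    intro S hSo hSc
    have hpos : 0 < νQv S := hSo.measure_pos νQv ⟨1, S.one_mem⟩
    exact_mod_cast (ENNReal.toReal_pos hpos.ne' hSc.measure_lt_top.ne).ne'
  have hint : ∀ S : Subgroup (Gqs L v), IsOpen (S : Set (Gqs L v)) → IsCompact (S : Set (Gqs L v)) → ∀ c : ℂ,
      Integrable (fun g => c * (S : Set (Gqs L v)).indicator (fun _ => (1 : ℂ)) g) νQv := fun S hSo hSc c =>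
    (((isLocSmooth_indicator_subgroup S hSo hSc).continuous.integrable_of_hasCompactSupport
      (isLocSmooth_indicator_subgroup S hSo hSc).hasCompactSupport)).const_mul c
  have hintv : ∀ S : Subgroup (Gqs L v), IsOpen (S : Set (Gqs L v)) → ∀ c : ℂ,
      ∫ g, c * (S : Set (Gqs L v)).indicator (fun _ => (1 : ℂ)) g ∂νQv = c * ((νQv S).toReal : ℂ) := by
    intro S hSo c
    rw [integral_const_mul, integral_indicator_const (1 : ℂ) hSo.measurableSet, Complex.real_smul, mul_one]
    rfl
  -- Kottwitz's function
  set fG : Gqs L v → ℂ := fun g => (((νQv K0).toReal : ℂ))⁻¹ * (K0 : Set (Gqs L v)).indicator (fun _ => (1 : ℂ)) g +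
      (((νQv K1).toReal : ℂ))⁻¹ * (K1 : Set (Gqs L v)).indicator (fun _ => (1 : ℂ)) g -
      (((νQv I).toReal : ℂ))⁻¹ * (I : Set (Gqs L v)).indicator (fun _ => (1 : ℂ)) g with hfGdef
  have hsmooth : IsLocSmooth fG := isLocSmooth_epCombination K0 K1 I hK0o hK0c hK1o hK1c hIo hIc _ _ _
  have iK0 := hint K0 hK0o hK0c ((((νQv K0).toReal : ℂ))⁻¹)
  have iK1 := hint K1 hK1o hK1c ((((νQv K1).toReal : ℂ))⁻¹)
  have iI := hint I hIo hIc ((((νQv I).toReal : ℂ))⁻¹)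
  have hfG1 : fG 1 = (((νQv K0).toReal : ℂ))⁻¹ + (((νQv K1).toReal : ℂ))⁻¹ - (((νQv I).toReal : ℂ))⁻¹ := by
    simp only [hfGdef, Set.indicator_of_mem (SetLike.mem_coe.2 K0.one_mem), Set.indicator_of_mem (SetLike.mem_coe.2 K1.one_mem),
      Set.indicator_of_mem (SetLike.mem_coe.2 I.one_mem), mul_one]
  have hfG1re : (fG 1).re = ((νQv K0).toReal)⁻¹ + ((νQv K1).toReal)⁻¹ - ((νQv I).toReal)⁻¹ := by
    rw [hfG1, ← Complex.ofReal_inv, ← Complex.ofReal_inv, ← Complex.ofReal_inv, ← Complex.ofReal_add, ← Complex.ofReal_sub, Complex.ofReal_re]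
  refine ⟨fG, hsmooth, hsmooth.continuous.measurable, (iK0.add iK1).sub iI, ?_, ?_, ?_, ?_, ?_⟩
  · -- mass one
    have h1 : ∫ g, fG g ∂νQv = (∫ g, (((νQv K0).toReal : ℂ))⁻¹ * (K0 : Set (Gqs L v)).indicator (fun _ => (1 : ℂ)) g ∂νQv +
        ∫ g, (((νQv K1).toReal : ℂ))⁻¹ * (K1 : Set (Gqs L v)).indicator (fun _ => (1 : ℂ)) g ∂νQv) -
        ∫ g, (((νQv I).toReal : ℂ))⁻¹ * (I : Set (Gqs L v)).indicator (fun _ => (1 : ℂ)) g ∂νQv := by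
      have h := integral_sub (μ := νQv)
        (f := fun g => (((νQv K0).toReal : ℂ))⁻¹ * (K0 : Set (Gqs L v)).indicator (fun _ => (1 : ℂ)) g +
          (((νQv K1).toReal : ℂ))⁻¹ * (K1 : Set (Gqs L v)).indicator (fun _ => (1 : ℂ)) g)
        (g := fun g => (((νQv I).toReal : ℂ))⁻¹ * (I : Set (Gqs L v)).indicator (fun _ => (1 : ℂ)) g) (iK0.add iK1) iI
      rw [integral_add iK0 iK1] at h
      exact h
    rw [h1, hintv K0 hK0o, hintv K1 hK1o, hintv I hIo, inv_mul_cancel₀ (hvol K0 hK0o hK0c), inv_mul_cancel₀ (hvol K1 hK1o hK1c),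
      inv_mul_cancel₀ (hvol I hIo hIc)]
    norm_num
  · -- `fG 1` is real
    rw [hfG1, ← Complex.ofReal_inv, ← Complex.ofReal_inv, ← Complex.ofReal_inv, ← Complex.ofReal_add, ← Complex.ofReal_sub, Complex.ofReal_im]
  · -- `fG 1 < 0` (★ (G7) from the indices `q³ + 1`, `q + 1` of ★ (G0), transported along `eA`)
    letI : Fintype 𝓀[w.1.adicCompletion L] := Fintype.ofFinite _
    obtain ⟨σk, hσk⟩ := UnitaryLatticeTree.exists_residueField_ringHom_of_v_eq (K := w.1.adicCompletion L)
      (fun y => valued_galAdicCompletionMap (L := L) (IsCMField.complexConj L) hw y)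
    have hidx := UnitaryLatticeTree.index_inf_subgroupOf_eq_of_unramified hd
      (UnitaryLatticeTree.galAdicCompletionMap_mem_valuedInteger (IsCMField.complexConj L) v w hw) σk hσk
      (UnitaryLatticeTree.fintypeCard_valuedResidueField_eq_sq_of_inert (IsCMField.complexConj L) v hc1 hunr w hw)
      (UnitaryLatticeTree.residueHom_galAdicCompletionMap_eq_pow_valued (IsCMField.complexConj L) v hc1 hunr w hw σk hσk) g₁ hg₁
    have h0 : (I.subgroupOf K0).index = Nat.card (𝓞 ↥(maximalRealSubfield L) ⧸ v.asIdeal) ^ 3 + 1 := by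
      rw [hIdef, hK0def, index_subgroupOf_comap_mulEquiv]; exact hidx.1
    have h1 : (I.subgroupOf K1).index = Nat.card (𝓞 ↥(maximalRealSubfield L) ⧸ v.asIdeal) + 1 := by
      rw [hIdef, hK1def, index_subgroupOf_comap_mulEquiv]; exact hidx.2
    haveI : (I.subgroupOf K0).FiniteIndex := ⟨by rw [h0]; exact Nat.succ_ne_zero _⟩
    haveI : (I.subgroupOf K1).FiniteIndex := ⟨by rw [h1]; exact Nat.succ_ne_zero _⟩
    have hq2 : 2 ≤ Nat.card (𝓞 ↥(maximalRealSubfield L) ⧸ v.asIdeal) := by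
      haveI : Finite (𝓞 ↥(maximalRealSubfield L) ⧸ v.asIdeal) := Ideal.finiteQuotientOfFreeOfNeBot v.asIdeal v.ne_bot
      haveI : Nontrivial (𝓞 ↥(maximalRealSubfield L) ⧸ v.asIdeal) := Ideal.Quotient.nontrivial_iff.2 v.isPrime.ne_top
      exact Finite.one_lt_card
    have hmpos : 0 < (νQv I).toReal :=
      ENNReal.toReal_pos (hIo.measure_pos νQv ⟨1, I.one_mem⟩).ne' hIc.measure_lt_top.ne
    have ha : (νQv K0).toReal = ((Nat.card (𝓞 ↥(maximalRealSubfield L) ⧸ v.asIdeal) : ℝ) ^ 3 + 1) * (νQv I).toReal := by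
      have h := UnitaryLatticeTree.measureReal_coe_eq_index_mul νQv (Subgroup.comap_mono inf_le_left : I ≤ K0) hIo
      rw [h0, measureReal_def, measureReal_def] at h
      rw [h]; push_cast; ring
    have hb : (νQv K1).toReal = ((Nat.card (𝓞 ↥(maximalRealSubfield L) ⧸ v.asIdeal) : ℝ) + 1) * (νQv I).toReal := by
      have h := UnitaryLatticeTree.measureReal_coe_eq_index_mul νQv (Subgroup.comap_mono inf_le_right : I ≤ K1) hIo
      rw [h1, measureReal_def, measureReal_def] at h
      rw [h]; push_cast; ring
    rw [hfG1re]
    exact (UnitaryLatticeTree.epValueAtOne_eq_and_neg hmpos hq2 ha hb).2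
  · -- elliptic regular classes: (E) = ★ EULER-G on `UA`, finiteness from the compact centraliser and the closed regular class, counts transported along `eA`
    intro γ hreg hZc
    haveI : CompactSpace (Subgroup.centralizer ({γ} : Set (Gqs L v))) := isCompact_iff_compactSpace.1 hZc
    have hO := UnitaryGroup.isClosed_conjClass_local_of_isRegularElt L 3 (qsForm L) v hHf hdetf γ hreg
    -- finiteness of the fixed sets, proved on `G_v` and moved to `UA`
    have hfin : ∀ C : Subgroup ↥UA, IsOpen ((C.comap eA.toMulEquiv.toMonoidHom : Subgroup (Gqs L v)) : Set (Gqs L v)) →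
        IsCompact ((C.comap eA.toMulEquiv.toMonoidHom : Subgroup (Gqs L v)) : Set (Gqs L v)) → (MulAction.fixedBy (↥UA ⧸ C) (eA γ)).Finite := by
      intro C hCo hCc
      haveI := (finite_fixedBy_quotient_of_isClosed γ (C.comap eA.toMulEquiv.toMonoidHom) hO hCo hCc).to_subtype
      obtain ⟨Φ, -⟩ := exists_equiv_fixedBy_quotient_congr (C.comap eA.toMulEquiv.toMonoidHom) C eA.toMulEquiv (fun g => Iff.rfl) γ
      exact Set.finite_coe_iff.1 (Finite.of_equiv _ Φ)
    -- the centraliser of `eA γ` in `UA` is the (compact) image of `Z(γ)`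
    have hZeq : ((Subgroup.centralizer ({eA γ} : Set ↥UA)) : Set ↥UA) = eA '' ((Subgroup.centralizer ({γ} : Set (Gqs L v))) : Set (Gqs L v)) := by
      ext u
      simp only [SetLike.mem_coe, Subgroup.mem_centralizer_singleton_iff, Set.mem_image]
      constructor
      · intro hu
        refine ⟨eA.symm u, ?_, eA.apply_symm_apply u⟩
        apply eA.injective
        rw [map_mul, map_mul, eA.apply_symm_apply]
        exact hu
      · rintro ⟨g, hg, rfl⟩
        rw [← map_mul, ← map_mul, hg]
    have hZc' : IsCompact ((Subgroup.centralizer ({eA γ} : Set ↥UA)) : Set ↥UA) := by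
      rw [hZeq]; exact hZc.image eA.continuous
    haveI : CompactSpace (Subgroup.centralizer ({eA γ} : Set ↥UA)) := isCompact_iff_compactSpace.1 hZc'
    have hK0wo : IsOpen (K0w : Set ↥UA) := by
      rw [hK0wdef]; exact UnitaryLatticeTree.isOpen_glInt_subgroupOf σ ((StdForm.antidiagonal 3).over (w.1.adicCompletion L))
    have horb := finite_range_pow_quotient_of_isOpen (G := ↥UA) (eA γ) K0w hK0wo
    have hE := UnitaryLatticeTree.natCard_fixedBy_add_eq_natCard_fixedBy_inf_add_one_three hd g₁ hg₁ (eA γ) (hfin K0w hK0o hK0c) (hfin K1w hK1o hK1c) horb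
    rw [hfGdef, classOrbitalIntegral_epCombination_eq_of_compactSpace L 3 (qsForm L) v νQv hHf hdetf hcanQ K0 K1 I hK0o hK0c hK1o hK1c hIo hIc γ hreg,
      natCard_fixedBy_quotient_congr K0 K0w eA.toMulEquiv (fun g => Iff.rfl) γ, natCard_fixedBy_quotient_congr K1 K1w eA.toMulEquiv (fun g => Iff.rfl) γ,
      natCard_fixedBy_quotient_congr I (K0w ⊓ K1w) eA.toMulEquiv (fun g => Iff.rfl) γ]
    have hE' : (Nat.card (MulAction.fixedBy (↥UA ⧸ K0w) (eA.toMulEquiv γ)) : ℂ) + (Nat.card (MulAction.fixedBy (↥UA ⧸ K1w) (eA.toMulEquiv γ)) : ℂ) =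
        (Nat.card (MulAction.fixedBy (↥UA ⧸ (K0w ⊓ K1w)) (eA.toMulEquiv γ)) : ℂ) + 1 := by exact_mod_cast hE
    rw [hE', add_sub_cancel_left]
  · -- non-elliptic regular classes: (N) = LH6-p03's ★ (G1) ASSEMBLY `epNonEllipticCombination_eq_zero_three`, its kit binders (T1) := §0 and (T2) := ★ p852912
    intro γ hreg hZnc
    have hnc : ¬ CompactSpace (Subgroup.centralizer ({γ} : Set (Gqs L v))) := fun h => hZnc (isCompact_iff_compactSpace.2 h)
    -- the three levels by membership through `eU`
    have hmem : ∀ (C : Subgroup (GL (Fin 3) (w.1.adicCompletion L))) (g : Gqs L v),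
        g ∈ ((C.subgroupOf UA).comap eA.toMulEquiv.toMonoidHom : Subgroup (Gqs L v)) ↔
          ((eU g : ↥(unitaryGroupOfForm σ (placeForm (qsForm L) w.1))) : GL (Fin 3) (w.1.adicCompletion L)) ∈ C := by
      intro C g
      rw [Subgroup.mem_comap, Subgroup.mem_subgroupOf, ← heA g]
      rfl
    have hImem : ∀ g : Gqs L v, g ∈ I ↔
        ((eU g : ↥(unitaryGroupOfForm σ (placeForm (qsForm L) w.1))) : GL (Fin 3) (w.1.adicCompletion L)) ∈ glInt 3 (w.1.adicCompletion L) ∧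
          ((eU g : ↥(unitaryGroupOfForm σ (placeForm (qsForm L) w.1))) : GL (Fin 3) (w.1.adicCompletion L)) ∈
            (glInt 3 (w.1.adicCompletion L)).map (MulAut.conj g₁).toMonoidHom := by
      intro g
      rw [hIdef, Subgroup.mem_comap, Subgroup.mem_inf, hK0wdef, hK1wdef, Subgroup.mem_subgroupOf, Subgroup.mem_subgroupOf, ← heA g]
      rfl
    -- the antidiagonal shape of `(Φ₃)_w`
    have hform := TypeThreeTorus.placeForm_qsForm_eq L w
    have hJ : ∀ i j : Fin 3, j ≠ Fin.rev i → placeForm (qsForm L) w.1 i j = 0 := by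
      intro i j hij
      rw [hform]
      fin_cases i <;> fin_cases j <;> first | rfl | exact absurd (by decide) hij
    have hH₀₂ : placeForm (qsForm L) w.1 0 2 ≠ 0 := by rw [hform]; exact one_ne_zero
    have hH₁₁ : placeForm (qsForm L) w.1 1 1 ≠ 0 := by rw [hform]; exact one_ne_zero
    -- (T1) := §0, valuations re-read at the datum's uniformiser `ϖ` (`|ι_w ϖ_v| = |ϖ| = exp (−1)` at the unramified `v`)
    have hvϖ' : Valued.v (toPlace v w (HeckeCharacter.uniformizer ↥(maximalRealSubfield L) v : v.adicCompletion ↥(maximalRealSubfield L))) = Valued.v ϖ := by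
      rw [valued_toPlace_uniformizer L v w hunr, hd.vϖ]
    have hT1 : ∀ γ : Gqs L v, IsRegularElt (γ.val : GL (Fin 3) (UnitaryGroup.LocalRing L v)) →
        ¬ CompactSpace (Subgroup.centralizer ({γ} : Set (Gqs L v))) →
        ∃ (g : Gqs L v) (e : Fin 3 → w.1.adicCompletion L) (c : ℤ),
          (((eU (g * γ * g⁻¹) : ↥(unitaryGroupOfForm σ (placeForm (qsForm L) w.1))) : GL (Fin 3) (w.1.adicCompletion L)) :
              Matrix (Fin 3) (Fin 3) (w.1.adicCompletion L)) = Matrix.diagonal e ∧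
            Valued.v (e 0) = Valued.v (ϖ ^ c) ∧ Valued.v (e 1) = 1 ∧ Valued.v (e 2) = Valued.v (ϖ ^ (-c)) := by
      intro γ hreg hncs
      have hnc' : ¬ IsCompact ((Subgroup.centralizer ({γ} : Set (Gqs L v))) : Set (Gqs L v)) := fun h => hncs (isCompact_iff_compactSpace.1 h)
      obtain ⟨γ', d, c, hconj, hm, -, hv0, hv1, hv2⟩ :=
        exists_conj_coe_localNonsplitEquiv_eq_diagonal_of_not_isCompact_centralizer L v hns hunr w hw hreg hnc'
      obtain ⟨g, hg⟩ := isConj_iff.1 hconj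
      refine ⟨g, d, c, by rw [hg]; exact hm, ?_, hv1, ?_⟩
      · rw [hv0, map_zpow₀, map_zpow₀, hvϖ']
      · rw [hv2, map_zpow₀, map_zpow₀, hvϖ']
    -- (T2) := ★ p852912 `exists_splitTorus_generator_local_of_nonsplit_three` (regularity of the diagonal from the separable characteristic polynomial)
    have hT2 : ∀ δ : Gqs L v, IsRegularElt (δ.val : GL (Fin 3) (UnitaryGroup.LocalRing L v)) →
        (∃ e : Fin 3 → w.1.adicCompletion L,
          (((eU δ : ↥(unitaryGroupOfForm σ (placeForm (qsForm L) w.1))) : GL (Fin 3) (w.1.adicCompletion L)) :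
              Matrix (Fin 3) (Fin 3) (w.1.adicCompletion L)) = Matrix.diagonal e) →
        ∃ τ : Subgroup.centralizer ({δ} : Set (Gqs L v)),
          (((eU (τ : Gqs L v) : ↥(unitaryGroupOfForm σ (placeForm (qsForm L) w.1))) : GL (Fin 3) (w.1.adicCompletion L)) :
              Matrix (Fin 3) (Fin 3) (w.1.adicCompletion L)) = Matrix.diagonal ![ϖ⁻¹, 1, ϖ] ∧
          (∀ c' : Subgroup.centralizer ({δ} : Set (Gqs L v)), ∃ n : ℤ, c' * (τ ^ n)⁻¹ ∈ compactCore (Subgroup.centralizer ({δ} : Set (Gqs L v)))) ∧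
          (∀ n : ℤ, τ ^ n ∈ compactCore (Subgroup.centralizer ({δ} : Set (Gqs L v))) → n = 0) := by
      rintro δ hregδ ⟨e, hδm⟩
      haveI := isDiscreteValuationRing_integer_of_compatible hd.vϖ
      have hsep : (Matrix.diagonal e).charpoly.Separable := by
        rw [← hδm]; exact (TypeThreeTorus.isRegularElt_iff_separable_localNonsplitEquiv L w hw _).1 hregδ
      have hinj : Function.Injective e := by
        rw [Matrix.charpoly_diagonal] at hsep; exact Polynomial.separable_prod_X_sub_C_iff.1 hsep
      exact exists_splitTorus_generator_local_of_nonsplit_three (IsCMField.complexConj L) (qsForm L) hc1 w hw hJ hH₀₂ hH₁₁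
        (isUniformizingElement_of_v_eq hd.vϖ) hd.σϖ hδm (fun i j hij => isUnit_iff_ne_zero.2 (sub_ne_zero.2 fun h => hij (hinj h)))
    -- `Φ(ν(C)⁻¹ · 𝟙_C) = ν(C)⁻¹ · Φ(𝟙_C)` ×3 (★ linearity at a regular class), then the ★ assembly
    rw [hfGdef, classOrbitalIntegral_epCombination_eq L 3 (qsForm L) v hHf hdetf hcanQ.isAdmissibleOn K0 K1 I hK0o hK0c hK1o hK1c hIo hIc _ _ _ γ hreg]
    exact epNonEllipticCombination_eq_zero_three L w hw νQv hcanQ hd g₁ hg₁ K0 K1 I (hmem _) (hmem _) hImem hK0o hK0c hK1o hK1c hIo hIc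
      hT1 hT2 γ hreg hnc

end Summit.HodgeConjecture.HodgeConjecture.Cruxes.H413.F0P3cStCharTSEPGlueG

end
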